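import Summits.CriticalPhenomena.PercolationContinuityZ3.Theorems.PercNearOneGluingNoHeavyLowerTailPocketWitnessGlued
import Summits.CriticalPhenomena.PercolationContinuityZ3.Theorems.PercNearOneGluingNoHeavyLowerTailTypedReductions
import HarnessLib

/-!
# `NoHeavyLowerTail` (stmt-CriticalPhenomena-4575) — typed socket: a POCKET-WITNESS BOUND WITH CONSTANTS gives the crux

Support file (engine seat `prim-cplus-engine` gen 9, 2026-08-20; `--supports stmt-CriticalPhenomena-4575`).  No definitions,
no named facts, no sorries.  Bookkeeping only.

With `pocketWitnessBound_glued` (tree, this seat) the crux follows from any bound, UNIFORM over finite weighted graphs, of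
the glued pocket-witness sum by a constant multiple of the worst relay deadness: if for some `C` every instance
(`o ∉ A`, `μ(a ↮ b) ≤ t` on `A`) admits a valid witness rule `a(·)` (for each pocket value `S₀ ∋ o` disjoint from `A`, a vertex
`a S₀ ∉ S₀` at most as connected to `b` avoiding `S₀` as every port of `S₀`) with
  `Σ_{S₀} min( μ(P = S₀), μ(Span S₀)·μ(Cl S₀ ∩ {a S₀ ↮ b in ω ∪ S₀⁽²⁾}) ) ≤ C·t`,
then `μ(o ↔ A, o ↮ b) ≤ C·t`, hence Kozma–Nitzan's Conjecture 3 (`NearOneGluing`, `δ := ε/(2(1+|C|))`) and the crux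
`NoHeavyLowerTail` (tree: `manyFingersLargePocket_of_nearOneGluing`, `noHeavyLowerTail_of_manyFingersLargePocket`).

* `nearOneGluing_of_pocketWitnessConst`, `noHeavyLowerTail_of_pocketWitnessConst`.

The hypothesis with the PORT rule `a S₀ := argmin_{ports of S₀} μ(· ↔ b in S₀ᶜ)` is the conjecture "port-witness pocket bound"
of the seat memo ENGINE-g9.md §2 (exact numerics: ratio to `t` ≤ 1.0 on the structured families, 1.4 under adversarial climbing at
`n ≤ 5`, kit j078550 for `n ≤ 7`; the lead's selection-inequality census in N-form: ≤ 2).  Constant 1 is FALSE (an `n = 5` instance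
with ratio 1.38 is recorded in the memo), so the socket is stated with a free constant.
[cite: KozmaNitzan2024, Conj. 3 (p. 15), Thm. 4 (p. 12)]
-/

namespace Summit.CriticalPhenomena.PercolationContinuityZ3.Theorems

open scoped BigOperators Classical
open MeasureTheory Set
open Literature.Probability.LatticeModels (prodBernoulli)
open Literature.Probability.Percolation

/-- **A pocket-witness bound with a constant ⇒ Kozma–Nitzan's Conjecture 3 (`NearOneGluing`).**  [this file] -/
theorem nearOneGluing_of_pocketWitnessConst
    (hPW : ∃ C : ℝ, ∀ (n : ℕ) (w : Sym2 (Fin n) → unitInterval) (A : Finset (Fin n)) (o b : Fin n) (t : ℝ),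
      0 ≤ t → o ∉ A →
      (∀ a ∈ A, (prodBernoulli w).real (openConn a b)ᶜ ≤ t) →
      ∃ a : Finset (Fin n) → Fin n,
        (∀ S₀ : Finset (Fin n), o ∈ S₀ → Disjoint S₀ A → a S₀ ∉ S₀ ∧
          ∀ p ∈ A, (∃ x ∈ S₀, w s(x, p) ≠ 0) →
            (prodBernoulli w).real (openConnIn ((↑S₀ : Set (Fin n))ᶜ) (a S₀) b) ≤
              (prodBernoulli w).real (openConnIn ((↑S₀ : Set (Fin n))ᶜ) p b)) ∧
        ∑ S₀ ∈ (Finset.univ : Finset (Finset (Fin n))).filter (fun S₀ => o ∈ S₀ ∧ Disjoint S₀ A),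
          min ((prodBernoulli w).real
                {ω | ∀ v : Fin n, ω ∈ openConnIn (↑A : Set (Fin n))ᶜ o v ↔ v ∈ S₀})
              ((prodBernoulli w).real {ω | ∀ v ∈ S₀, ω ∈ openConnIn (↑S₀ : Set (Fin n)) o v} *
                (prodBernoulli w).real
                  ({ω | ∀ x ∈ S₀, ∀ y : Fin n, y ∉ S₀ → y ∉ A → s(x, y) ∉ ω} ∩
                    {ω | ω ∪ (↑S₀.sym2 : Set (Sym2 (Fin n))) ∉ openConn (a S₀) b})) ≤ C * t) :
    Summit.CriticalPhenomena.PercolationContinuityZ3.Theses.PercNearOneGluing.NearOneGluing := by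
  obtain ⟨C, hC⟩ := hPW
  intro ε hε
  set C' : ℝ := max C 0 with hC'def
  have hC'0 : 0 ≤ C' := le_max_right _ _
  have hCC' : C ≤ C' := le_max_left _ _
  refine ⟨ε / (2 * (1 + C')), by positivity, ?_⟩
  intro n w A o b hoA hab
  set δ : ℝ := ε / (2 * (1 + C')) with hδdef
  have hδpos : 0 < δ := by positivity
  have hδε : δ + C' * δ < ε := by
    have h1 : δ + C' * δ = (1 + C') * δ := by ring
    have h2 : (1 + C') * δ = ε / 2 := by
      rw [hδdef]; field_simp
    rw [h1, h2]; linarith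
  set μ := prodBernoulli w with hμ
  by_cases ho : o ∈ A
  · have h := hab o ho
    linarith [show C' * δ ≥ 0 from mul_nonneg hC'0 hδpos.le]
  -- relays are `δ`-reliable
  have hrel : ∀ a ∈ A, μ.real (openConn a b)ᶜ ≤ δ := by
    intro a ha
    rw [probReal_compl_eq_one_sub MeasurableSet.of_discrete]
    have := hab a ha
    linarith
  obtain ⟨a, hrule, hsum⟩ := hC n w A o b δ hδpos.le ho hrel
  have hbad := (pocketWitnessBound_glued n w A o b a ho hrule).trans hsum
  -- `μ(o ↔ A) ≤ μ(o ↔ b) + bad`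
  set U : Set (Set (Sym2 (Fin n))) := ⋃ x ∈ A, openConn o x with hU
  have hsplit := measureReal_inter_add_sdiff (μ := μ) (s := U) (t := openConn o b)
    MeasurableSet.of_discrete (measure_ne_top _ _)
  have h1 : μ.real (U ∩ openConn o b) ≤ μ.real (openConn o b) := measureReal_mono Set.inter_subset_right
  have h2 : μ.real (U \ openConn o b) ≤ C * δ := by rw [Set.sdiff_eq]; exact hbad
  have h3 : C * δ ≤ C' * δ := mul_le_mul_of_nonneg_right hCC' hδpos.le
  change 1 - ε < μ.real (openConn o b)
  change 1 - δ < μ.real U at hoA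
  linarith

/-- **A pocket-witness bound with a constant ⇒ the crux `NoHeavyLowerTail`** (stmt-CriticalPhenomena-4575).  [this file] -/
theorem noHeavyLowerTail_of_pocketWitnessConst
    (hPW : ∃ C : ℝ, ∀ (n : ℕ) (w : Sym2 (Fin n) → unitInterval) (A : Finset (Fin n)) (o b : Fin n) (t : ℝ),
      0 ≤ t → o ∉ A →
      (∀ a ∈ A, (prodBernoulli w).real (openConn a b)ᶜ ≤ t) →
      ∃ a : Finset (Fin n) → Fin n,
        (∀ S₀ : Finset (Fin n), o ∈ S₀ → Disjoint S₀ A → a S₀ ∉ S₀ ∧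
          ∀ p ∈ A, (∃ x ∈ S₀, w s(x, p) ≠ 0) →
            (prodBernoulli w).real (openConnIn ((↑S₀ : Set (Fin n))ᶜ) (a S₀) b) ≤
              (prodBernoulli w).real (openConnIn ((↑S₀ : Set (Fin n))ᶜ) p b)) ∧
        ∑ S₀ ∈ (Finset.univ : Finset (Finset (Fin n))).filter (fun S₀ => o ∈ S₀ ∧ Disjoint S₀ A),
          min ((prodBernoulli w).real
                {ω | ∀ v : Fin n, ω ∈ openConnIn (↑A : Set (Fin n))ᶜ o v ↔ v ∈ S₀})
              ((prodBernoulli w).real {ω | ∀ v ∈ S₀, ω ∈ openConnIn (↑S₀ : Set (Fin n)) o v} *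
                (prodBernoulli w).real
                  ({ω | ∀ x ∈ S₀, ∀ y : Fin n, y ∉ S₀ → y ∉ A → s(x, y) ∉ ω} ∩
                    {ω | ω ∪ (↑S₀.sym2 : Set (Sym2 (Fin n))) ∉ openConn (a S₀) b})) ≤ C * t) :
    Summit.CriticalPhenomena.PercolationContinuityZ3.Theses.PercNearOneGluing.NoHeavyLowerTail :=
  noHeavyLowerTail_of_manyFingersLargePocket
    (manyFingersLargePocket_of_nearOneGluing (nearOneGluing_of_pocketWitnessConst hPW))

end Summit.CriticalPhenomena.PercolationContinuityZ3.Theorems
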